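import Literature.AlgebraicGeometry.Resolution.PointBlowupMohBound
import HarnessLib

/-!
# Hauser's kangaroo in the point-blowup model: the jump `2 → 3`, no second jump, and a stall

Topic: `Literature/AlgebraicGeometry/Resolution`. A worked example (cell `pub-hironaka`, unit
`b2b-hironaka-cp4`, DIM-4 CENSUS gen 11) tying the point-blowup model of `PointBlowupShade.lean`
(`PointBlowup.State`, `step`, `shade`, `IsKangarooPoint`, `HauserConditions`, `MohBound`,
`ShadeStalls`) to the tree's kernel-checked data of Hauser's characteristic-`2` example
(`Literature/Barriers/ResolutionOfSingularities/KangarooShadeIncrease.lean`: `antelopeResidual`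
`F² = y³z³(y² + z²)`, `antelopeMult` `r = (3,3)`, `kangarooResidual` `F³ = z⁶(y⁵ + y⁴ + y³ + y²)`,
`kangarooMult` `r' = (0,6)`; [Hauser2010, §K], [Hauser2003, §14 Example 2]), and instantiating
the general theorems of `PointBlowupMohBound.lean` on it:

* ONE `step` of the model at the antelope state `(F², (3,3))`, order `p = 2`, at the point
  `(y, z) = (1, 0)` of the `z`-chart (`j = 1`, `b = ![1, 0]`; Hauser's substitution
  `(x,y,z) ↦ (xz, yz + z, z)`): the chart transform is `y⁵z⁶ + y³z⁶` (`chartTransform_antelope`),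
  the translation `y ↦ y + 1` gives EXACTLY `F³` (`pointTransform_antelope`), the cleaning deletes
  the two square monomials `y⁴z⁶ = (y²z³)²` and `y²z⁶ = (yz³)²` (`deletePthPowers_kangarooResidual`:
  the result is `z⁶(y⁵ + y³) = F³ + (yz³ + y²z³)²`, `deletePthPowers_kangarooResidual_eq_add_sq`;
  Hauser's text performs only `x ↦ x + yz³`, keeping the square `y⁴z⁶` of degree `10`, which does
  not affect the order `9`), and the new multiplicities are `(0, 6)` (`newMult_antelope`):
  `step_antelope`. So the model's `step` reproduces the printed passage `f² ↦ f³` [Hauser2010, §K]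
  up to the model's complete cleaning.
* `shade = 8 − 6 = 2` before and `9 − 6 = 3` after (`shade_antelope`, `shade_kangarooClean`); the
  point is equimultiple, hence a kangaroo point of the model, the antelope state is an antelope
  point (`isKangarooPoint_antelope`, `isAntelopePoint_antelope`), Hauser's necessary conditions
  (1)–(3) hold (`hauserConditions_antelope`), and Moh's bound holds with EQUALITY
  (`mohBound_antelope`: `3 = 2 + 2⁰`) — the predicates of `PointBlowupShade.lean` are inhabited by
  the example they transcribe, over ANY field of characteristic `2` (compare
  `PointBlowup.shade_kangaroo_example`: perfect field, via graphs).
* **No second jump** (`not_shadeIncreases_after_kangaroo`): by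
  `PointBlowup.not_shadeIncreases_step_of_shadeIncreases` (no two consecutive increases at order
  `p`, every dimension), at every point `b'` (`b'_{j'} = 0`) of every chart `y_{j'}` of the next
  point blow-up of the kangaroo state `(z⁶(y⁵ + y³), (0,6))` the shade does not increase.
* **But it need not drop** (`step_kangaroo_origin`, `shadeStalls_kangaroo_origin`): at the ORIGIN
  of the `z`-chart the next state is `(y⁵z⁹ + y³z⁷, (0,7))`, equimultiple, shade `10 − 7 = 3`
  again. So the paraphrase "in the next blowup the shade has to drop at least by 1 (if `e = 1`)"
  [Hauser2010, §F p. 16, after Moh] does not hold point-by-point for point blow-ups in this model;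
  what holds at every point is "does not increase" (`not_shadeIncreases_step_of_shadeIncreases`),
  and Moh's "will not increase beyond `d + 1` until it drops to `d` or less" [Moh1987, p. 966] is
  consistent with the stalled branch. (Recorded as a scope remark; no claim about Moh's own
  centres, which follow a valuation.)

Generic helpers for binomials `y^{d₁} + y^{d₂}` with unit coefficients (`support_binomial`,
`ordZero_binomial`, `chartTransform_binomial`, `deletePthPowers_binomial`) carry the three explicit
states. Elementary `MvPolynomial (Fin 2) K` algebra. Census value only (row O5 of the dimension-4
census: the model and its theorems are non-vacuous on the printed example); NOT a statement about
resolution of singularities.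
-/

noncomputable section

open MvPolynomial Finset

open scoped BigOperators

namespace Literature.AlgebraicGeometry.Resolution

open Literature.AlgebraicGeometry.Resolution.Hauser2010
open Literature.Barriers.ResolutionOfSingularities

namespace PointBlowup

/-! ## Binomials with unit coefficients -/

section Binomial

variable {σ : Type*} {K : Type*} [Field K]

/-- The support of `y^{d₁} + y^{d₂}` (`d₁ ≠ d₂`) is `{d₁, d₂}`. [folklore] -/
theorem support_binomial [DecidableEq σ] {d₁ d₂ : σ →₀ ℕ} (h : d₁ ≠ d₂) :
    (monomial d₁ (1 : K) + monomial d₂ 1).support = {d₁, d₂} := by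
  ext d
  rw [MvPolynomial.mem_support_iff, coeff_add, coeff_monomial, coeff_monomial, Finset.mem_insert,
    Finset.mem_singleton]
  by_cases h1 : d₁ = d
  · subst h1; simp [h, h.symm]
  by_cases h2 : d₂ = d
  · subst h2; simp [h, h.symm]
  simp [h1, h2, Ne.symm h1, Ne.symm h2]

/-- `ord₀ (y^{d₁} + y^{d₂}) = |d₂|` when `|d₂| ≤ |d₁|` (`d₁ ≠ d₂`). [folklore] -/
theorem ordZero_binomial {d₁ d₂ : σ →₀ ℕ} (h : d₁ ≠ d₂) (hle : d₂.degree ≤ d₁.degree) :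
    ordZero (monomial d₁ (1 : K) + monomial d₂ 1) = d₂.degree := by
  classical
  apply le_antisymm
  · apply ordZero_le_of_coeff_ne_zero
    rw [coeff_add, coeff_monomial, coeff_monomial, if_neg h, if_pos rfl, zero_add]
    exact one_ne_zero
  · refine le_ordZero_of_forall _ _ fun d hd => ?_
    rw [coeff_add, coeff_monomial, coeff_monomial] at hd
    by_cases h1 : d₁ = d
    · subst h1; exact hle
    by_cases h2 : d₂ = d
    · subst h2; exact le_rfl
    simp [h1, h2] at hd

/-- The chart transform of `y^{d₁} + y^{d₂}` (`d₁ ≠ d₂`) is `y^{χ d₁} + y^{χ d₂}`,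
`χ = chartExponent q j`. [folklore] -/
theorem chartTransform_binomial [DecidableEq σ] (q : ℕ) (j : σ) {d₁ d₂ : σ →₀ ℕ} (h : d₁ ≠ d₂) :
    chartTransform q j (monomial d₁ (1 : K) + monomial d₂ 1) =
      monomial (chartExponent q j d₁) 1 + monomial (chartExponent q j d₂) 1 := by
  classical
  unfold chartTransform
  rw [support_binomial h, Finset.sum_pair h, coeff_add, coeff_add, coeff_monomial, coeff_monomial,
    coeff_monomial, coeff_monomial, if_pos rfl, if_pos rfl, if_neg h, if_neg (Ne.symm h), add_zero,
    zero_add]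

/-- Deleting `q`-th powers from `y^{d₁} + y^{d₂}` when neither exponent is a `q`-th power
exponent changes nothing. [folklore] -/
theorem deletePthPowers_binomial [DecidableEq σ] (q : ℕ) {d₁ d₂ : σ →₀ ℕ}
    (h₁ : ¬ IsPthPowerExponent q d₁) (h₂ : ¬ IsPthPowerExponent q d₂) :
    deletePthPowers q (monomial d₁ (1 : K) + monomial d₂ 1) = monomial d₁ 1 + monomial d₂ 1 := by
  rw [deletePthPowers_add, deletePthPowers_monomial, deletePthPowers_monomial, if_neg h₁, if_neg h₂]

/-- The translation by the origin is the identity. [folklore] -/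
theorem translate_zero (G : MvPolynomial σ K) : translate (0 : σ → K) G = G := by
  unfold translate
  have : (fun i => (X i + C ((0 : σ → K) i) : MvPolynomial σ K)) = X := by
    funext i; simp
  rw [this]
  exact MvPolynomial.aeval_X_left_apply G

end Binomial

/-! ## The example -/

section KangarooExample

variable (K : Type*) [Field K]

/-- Exponent arithmetic on `Fin 2`: an odd first exponent is not a square exponent. [folklore] -/
theorem not_isPthPowerExponent_two_of_odd {a : ℕ} (ha : a % 2 = 1) (c : ℕ) :
    ¬ IsPthPowerExponent 2 (Finsupp.single (0 : Fin 2) a + Finsupp.single 1 c) := by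
  rw [isPthPowerExponent_iff]
  intro h
  have h0 : (Finsupp.single (0 : Fin 2) a + Finsupp.single 1 c : Fin 2 →₀ ℕ) 0 = a := by simp
  have := h 0
  rw [h0] at this
  omega

/-- Two exponent vectors on `Fin 2` with different first entries differ. [folklore] -/
theorem single_add_single_ne {a a' c c' : ℕ} (h : a ≠ a') :
    (Finsupp.single (0 : Fin 2) a + Finsupp.single 1 c : Fin 2 →₀ ℕ) ≠
      Finsupp.single 0 a' + Finsupp.single 1 c' := by
  intro e
  have := DFunLike.congr_fun e 0
  simp at this
  exact h this

/-- The chart exponent of `(a, c)` in the `z`-chart (`j = 1`, `q = 2`) is `(a, a + c − 2)`.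
[cite: Hauser2010, §F (chart expressions)] -/
theorem chartExponent_fin_two (a c : ℕ) :
    chartExponent 2 (1 : Fin 2) (Finsupp.single 0 a + Finsupp.single 1 c) =
      Finsupp.single 0 a + Finsupp.single 1 (a + c - 2) := by
  ext i
  rw [chartExponent_apply]
  fin_cases i <;> simp [Finsupp.degree_eq_sum, Fin.sum_univ_two]

/-- `y^a z^c` as a monomial. [folklore] -/
theorem X_pow_mul_X_pow (a c : ℕ) :
    (X 0 ^ a * X 1 ^ c : MvPolynomial (Fin 2) K) =
      monomial (Finsupp.single 0 a + Finsupp.single 1 c) 1 := by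
  simp only [X_pow_eq_monomial, monomial_mul, mul_one]

/-! ### The antelope state `(F², (3,3))` -/

/-- `ord₀ F² = 8` (`F² = y⁵z³ + y³z⁵`). [cite: Hauser2010, §K] -/
theorem ordZero_antelopeResidual : ordZero (antelopeResidual K) = 8 := by
  rw [antelopeResidual_eq, ordZero_binomial (single_add_single_ne (by norm_num)) (by
    simp [Finsupp.degree_eq_sum, Fin.sum_univ_two])]
  simp [Finsupp.degree_eq_sum, Fin.sum_univ_two]

/-- The support of `F²` is `{(5,3), (3,5)}`. [folklore] -/
theorem support_antelopeResidual :
    (antelopeResidual K).support =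
      {Finsupp.single 0 5 + Finsupp.single 1 3, Finsupp.single 0 3 + Finsupp.single 1 5} := by
  rw [antelopeResidual_eq, support_binomial (single_add_single_ne (by norm_num))]

/-- `y^r ∣ F²`: every monomial of `F²` is divisible by `y³z³`. [cite: Hauser2010, §K] -/
theorem antelopeMult_le_of_mem_support :
    ∀ d ∈ (antelopeResidual K).support, antelopeMult ≤ d := by
  intro d hd
  rw [support_antelopeResidual, Finset.mem_insert, Finset.mem_singleton] at hd
  rcases hd with rfl | rfl <;> refine Finsupp.le_def.mpr fun i => ?_ <;> fin_cases i <;>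
    simp [antelopeMult]

/-- `F²` is clean: neither `y⁵z³` nor `y³z⁵` is a square. [cite: Hauser2010, §K] -/
theorem deletePthPowers_antelopeResidual :
    deletePthPowers 2 (antelopeResidual K) = antelopeResidual K := by
  rw [antelopeResidual_eq]
  exact deletePthPowers_binomial 2 (not_isPthPowerExponent_two_of_odd rfl 3)
    (not_isPthPowerExponent_two_of_odd rfl 5)

/-- `shade(F², (3,3)) = 8 − 6 = 2`. [cite: Hauser2010, §K ("`shade_{a₂} f² = 2`")] -/
theorem shade_antelope : (State.mk (antelopeResidual K) antelopeMult).shade = 2 := by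
  rw [shade_eq_of_ordZero_eq _ (ordZero_antelopeResidual K)]
  simp [antelopeMult, Finsupp.degree_eq_sum, Fin.sum_univ_two]

/-- **Chart transform** in the `z`-chart (`y ↦ yz`, division by `z²`):
`F²(yz, z)/z² = y⁵z⁶ + y³z⁶`. [cite: Hauser2010, §K (the substitution `(xz, yz, z)`)] -/
theorem chartTransform_antelope :
    chartTransform 2 1 (antelopeResidual K) = X 0 ^ 5 * X 1 ^ 6 + X 0 ^ 3 * X 1 ^ 6 := by
  rw [antelopeResidual_eq, chartTransform_binomial 2 1 (single_add_single_ne (by norm_num)),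
    chartExponent_fin_two, chartExponent_fin_two, X_pow_mul_X_pow, X_pow_mul_X_pow]

/-- **The translation `y ↦ y + 1` produces Hauser's `F³`**: the polynomial seen at the point
`(y, z) = (1, 0)` of the `z`-chart is `(y+1)⁵z⁶ + (y+1)³z⁶ = z⁶(y⁵ + y⁴ + y³ + y²)` in
characteristic `2`. [cite: Hauser2010, §K (`f³ = x² + z⁶(y⁵ + y⁴ + y³ + y²)` after `(xz, yz + z, z)`)] -/
theorem pointTransform_antelope [CharP K 2] :
    pointTransform 2 1 ![(1 : K), 0] (State.mk (antelopeResidual K) antelopeMult) =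
      kangarooResidual K := by
  have h2 : (2 : MvPolynomial (Fin 2) K) = 0 := by
    have := CharP.cast_eq_zero (MvPolynomial (Fin 2) K) 2
    exact_mod_cast this
  simp only [pointTransform, translate, chartTransform_antelope, map_add, map_mul, map_pow, aeval_X,
    Matrix.cons_val_zero, Matrix.cons_val_one, map_one, map_zero, add_zero]
  unfold kangarooResidual
  linear_combination (X 1 ^ 6 * (2 * X 0 ^ 4 + 5 * X 0 ^ 3 + 6 * X 0 ^ 2 + 4 * X 0 + 1)) * h2

/-! ### The kangaroo state `(z⁶(y⁵ + y³), (0,6))` -/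

/-- **Cleaning at the kangaroo point**: deleting the square monomials `y⁴z⁶ = (y²z³)²` and
`y²z⁶ = (yz³)²` from `F³ = z⁶(y⁵ + y⁴ + y³ + y²)` leaves `z⁶(y⁵ + y³)`. (Hauser's text performs
`x ↦ x + yz³` only, giving `z⁶y³(y² + y + 1)`; the model cleans completely — same order `9`.)
[cite: Hauser2010, §K (`f³ = x² + z⁶y³(y² + y + 1)` after `x ↦ x + yz³`)] [cite: Hauser2003, §14 Example 2] -/
theorem deletePthPowers_kangarooResidual :
    deletePthPowers 2 (kangarooResidual K) = X 0 ^ 5 * X 1 ^ 6 + X 0 ^ 3 * X 1 ^ 6 := by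
  classical
  have e : kangarooResidual K =
      (monomial (Finsupp.single 0 5 + Finsupp.single 1 6) 1 +
        monomial (Finsupp.single 0 3 + Finsupp.single 1 6) 1) +
      (monomial (Finsupp.single 0 4 + Finsupp.single 1 6) 1 +
        monomial (Finsupp.single 0 2 + Finsupp.single 1 6) 1) := by
    have h : kangarooResidual K =
        (X 0 ^ 5 * X 1 ^ 6 + X 0 ^ 3 * X 1 ^ 6) + (X 0 ^ 4 * X 1 ^ 6 + X 0 ^ 2 * X 1 ^ 6) := by
      unfold kangarooResidual; ring
    rw [h]
    simp only [X_pow_eq_monomial, monomial_mul, mul_one]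
  have p4 : IsPthPowerExponent 2 (Finsupp.single (0 : Fin 2) 4 + Finsupp.single 1 6) := by
    rw [isPthPowerExponent_iff]
    intro i
    fin_cases i <;> norm_num
  have p2 : IsPthPowerExponent 2 (Finsupp.single (0 : Fin 2) 2 + Finsupp.single 1 6) := by
    rw [isPthPowerExponent_iff]
    intro i
    fin_cases i <;> norm_num
  rw [e, deletePthPowers_add, deletePthPowers_binomial 2 (not_isPthPowerExponent_two_of_odd rfl 6)
    (not_isPthPowerExponent_two_of_odd rfl 6), deletePthPowers_add, deletePthPowers_monomial,
    deletePthPowers_monomial, if_pos p4, if_pos p2, add_zero, add_zero, X_pow_mul_X_pow,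
    X_pow_mul_X_pow]

/-- The model's cleaning is the coordinate change `x ↦ x + yz³ + y²z³` (characteristic `2`):
`z⁶(y⁵ + y³) = F³ + (yz³ + y²z³)²`; Hauser's `x ↦ x + yz³` is its first term (`kangarooGraph`).
[cite: Hauser2010, §K] [cite: Hauser2003, §14 Example 2] -/
theorem deletePthPowers_kangarooResidual_eq_add_sq [CharP K 2] :
    deletePthPowers 2 (kangarooResidual K) =
      kangarooResidual K + (kangarooGraph K + X 0 ^ 2 * X 1 ^ 3) ^ 2 := by
  have h2 : (2 : MvPolynomial (Fin 2) K) = 0 := by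
    have := CharP.cast_eq_zero (MvPolynomial (Fin 2) K) 2
    exact_mod_cast this
  rw [deletePthPowers_kangarooResidual]
  unfold kangarooResidual kangarooGraph
  linear_combination (-(X 1 ^ 6 * (X 0 ^ 4 + X 0 ^ 3 + X 0 ^ 2))) * h2

/-- The cleaned polynomial `z⁶(y⁵ + y³)` at the kangaroo point has order `9`.
[cite: Hauser2003, §14 Example 2 ("which, after deletion of `z⁶`, has order 3": `9 = 6 + 3`)] -/
theorem ordZero_kangarooClean :
    ordZero (X 0 ^ 5 * X 1 ^ 6 + X 0 ^ 3 * X 1 ^ 6 : MvPolynomial (Fin 2) K) = 9 := by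
  rw [X_pow_mul_X_pow, X_pow_mul_X_pow, ordZero_binomial (single_add_single_ne (by norm_num))
    (by simp [Finsupp.degree_eq_sum, Fin.sum_univ_two])]
  simp [Finsupp.degree_eq_sum, Fin.sum_univ_two]

/-- `shade(z⁶(y⁵ + y³), (0,6)) = 9 − 6 = 3`. [cite: Hauser2010, §K ("`shade_{a₃} f³ = 3`")]
[cite: Hauser2003, §14 Example 2] -/
theorem shade_kangarooClean :
    (State.mk (X 0 ^ 5 * X 1 ^ 6 + X 0 ^ 3 * X 1 ^ 6 : MvPolynomial (Fin 2) K) kangarooMult).shade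
      = 3 := by
  rw [shade_eq_of_ordZero_eq _ (ordZero_kangarooClean K)]
  simp [kangarooMult, Finsupp.degree_eq_sum]

/-- The kangaroo state is clean. [folklore] -/
theorem deletePthPowers_kangarooClean :
    deletePthPowers 2 (X 0 ^ 5 * X 1 ^ 6 + X 0 ^ 3 * X 1 ^ 6 : MvPolynomial (Fin 2) K) =
      X 0 ^ 5 * X 1 ^ 6 + X 0 ^ 3 * X 1 ^ 6 := by
  rw [X_pow_mul_X_pow, X_pow_mul_X_pow]
  exact deletePthPowers_binomial 2 (not_isPthPowerExponent_two_of_odd rfl 6)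
    (not_isPthPowerExponent_two_of_odd rfl 6)

/-- **Hauser's necessary conditions (1)–(3) hold at the example**: `2 ∣ |r| + shade = 8`;
`r̄ = (1,1)`, `1 + 1 ≤ 2`; no component `y_i = 0` with `2 ∤ r_i` passes through the point (the only
candidate `y = 0` is left, `b_0 ≠ 0`). (Computable counterpart: `KangarooAtlasCert.hauser_conditions`.)
[cite: Hauser2010, §G Kangaroo Theorem (1)–(3), Example 3] -/
theorem hauserConditions_antelope :
    HauserConditions 2 1 ![(1 : K), 0] (State.mk (antelopeResidual K) antelopeMult) := by
  refine ⟨?_, ?_, ?_⟩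
  · show 2 ∣ size (⇑antelopeMult) + (State.mk (antelopeResidual K) antelopeMult).shade.toNat
    rw [shade_antelope]
    simp [size, Fin.sum_univ_two, antelopeMult]
  · rw [multiplicityInequality_two_iff (by norm_num)]
    simp [antelopeMult]
  · intro i hi hb
    fin_cases i
    · simp at hb
    · exact absurd rfl hi

/-- The polynomial seen at the origin of the `z`-chart above the kangaroo state:
`(y⁵z⁶ + y³z⁶)(yz, z)/z² = y⁵z⁹ + y³z⁷`. [cite: Hauser2010, §F (chart expressions)] -/
theorem pointTransform_kangaroo_origin :
    pointTransform 2 1 (0 : Fin 2 → K)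
        (State.mk (X 0 ^ 5 * X 1 ^ 6 + X 0 ^ 3 * X 1 ^ 6 : MvPolynomial (Fin 2) K) kangarooMult) =
      X 0 ^ 5 * X 1 ^ 9 + X 0 ^ 3 * X 1 ^ 7 := by
  show translate 0 (chartTransform 2 1 (X 0 ^ 5 * X 1 ^ 6 + X 0 ^ 3 * X 1 ^ 6)) = _
  rw [translate_zero, X_pow_mul_X_pow, X_pow_mul_X_pow,
    chartTransform_binomial 2 1 (single_add_single_ne (by norm_num)), chartExponent_fin_two,
    chartExponent_fin_two, X_pow_mul_X_pow, X_pow_mul_X_pow]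

/-- The polynomial `y⁵z⁹ + y³z⁷` at the origin of the `z`-chart above the kangaroo has order `10`.
[folklore] -/
theorem ordZero_kangarooOriginClean :
    ordZero (X 0 ^ 5 * X 1 ^ 9 + X 0 ^ 3 * X 1 ^ 7 : MvPolynomial (Fin 2) K) = 10 := by
  rw [X_pow_mul_X_pow, X_pow_mul_X_pow, ordZero_binomial (single_add_single_ne (by norm_num))
    (by simp [Finsupp.degree_eq_sum, Fin.sum_univ_two])]
  simp [Finsupp.degree_eq_sum, Fin.sum_univ_two]

variable [DecidableEq K]

/-- **The new exceptional multiplicities** at the point `(1, 0)` of the `z`-chart: the component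
`y = 0` is lost (`b_0 = 1 ≠ 0`), the new component `z = 0` gets `ord₀ F² − 2 = 6`: `r' = (0, 6)`.
[cite: Hauser2010, §K] [cite: Hauser2008Kangaroo, §A (transform of D)] -/
theorem newMult_antelope :
    newMult 2 1 ![(1 : K), 0] (State.mk (antelopeResidual K) antelopeMult) = kangarooMult := by
  rw [newMult_eq 2 1 _ (by simp) _ (ordZero_antelopeResidual K)]
  ext i
  fin_cases i <;> simp [antelopeMult, kangarooMult]

/-- **One step of the model reproduces `f² ↦ f³`** [Hauser2010, §K]: chart `z`, point `(1, 0)`,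
cleaning, new multiplicities — the new state is `(z⁶(y⁵ + y³), (0, 6))`.
[cite: Hauser2010, §K] [cite: Hauser2003, §14 Example 2] -/
theorem step_antelope [CharP K 2] :
    step 2 1 ![(1 : K), 0] (State.mk (antelopeResidual K) antelopeMult) =
      State.mk (X 0 ^ 5 * X 1 ^ 6 + X 0 ^ 3 * X 1 ^ 6) kangarooMult := by
  show State.mk (deletePthPowers 2 (pointTransform 2 1 ![(1 : K), 0]
      (State.mk (antelopeResidual K) antelopeMult)))
      (newMult 2 1 ![(1 : K), 0] (State.mk (antelopeResidual K) antelopeMult)) = _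
  rw [pointTransform_antelope, deletePthPowers_kangarooResidual, newMult_antelope]

/-- `shade` after the step `= 3`. [cite: Hauser2010, §K ("`shade_{a₃} f³ = 3`")] -/
theorem shade_step_antelope [CharP K 2] :
    (step 2 1 ![(1 : K), 0] (State.mk (antelopeResidual K) antelopeMult)).shade = 3 := by
  rw [step_antelope, shade_kangarooClean]

/-- **The shade increases** at the point `(1, 0)` of the `z`-chart: `2 < 3`.
[cite: Hauser2010, §K ("the residual order has increased")] -/
theorem shadeIncreases_antelope [CharP K 2] :
    ShadeIncreases 2 1 ![(1 : K), 0] (State.mk (antelopeResidual K) antelopeMult) := by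
  unfold ShadeIncreases
  rw [shade_antelope, shade_step_antelope]
  exact_mod_cast (show (2 : ℕ) < 3 by norm_num)

/-- **Moh's bound holds at the example with equality**: `shade' = shade + p^{e−1} = 2 + 1`
(`MohBound 2 1`, the predicate of `PointBlowupShade.lean`, proved in general by
`PointBlowup.mohBound_one`). [cite: Moh1987, Stability Theorem] [cite: Hauser2010, §F Proposition] -/
theorem mohBound_antelope [CharP K 2] :
    MohBound 2 1 1 ![(1 : K), 0] (State.mk (antelopeResidual K) antelopeMult) ∧
    (step 2 1 ![(1 : K), 0] (State.mk (antelopeResidual K) antelopeMult)).shade =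
      (State.mk (antelopeResidual K) antelopeMult).shade + ((2 ^ (1 - 1) : ℕ) : ℕ∞) := by
  have h : (step 2 1 ![(1 : K), 0] (State.mk (antelopeResidual K) antelopeMult)).shade =
      (State.mk (antelopeResidual K) antelopeMult).shade + ((2 ^ (1 - 1) : ℕ) : ℕ∞) := by
    rw [shade_step_antelope, shade_antelope]
    norm_num
  refine ⟨?_, h⟩
  unfold MohBound
  rw [pow_one]
  exact h.le

/-- The point is **equimultiple**: `F³` has no monomial of degree `1` (its order is `8 ≥ 2`).
[cite: Hauser2010, §K (the order stays `2`)] -/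
theorem isEquimultiplePoint_antelope [CharP K 2] :
    IsEquimultiplePoint 2 1 ![(1 : K), 0] (State.mk (antelopeResidual K) antelopeMult) := by
  intro d _ hdeg
  rw [pointTransform_antelope]
  by_contra h
  have h8 := ordZero_le_of_coeff_ne_zero (kangarooResidual K) d h
  rw [ordZero_kangarooResidual K] at h8
  have : (8 : ℕ) ≤ d.degree := by exact_mod_cast h8
  omega

/-- **A kangaroo point of the model**: `b_j = 0`, equimultiple, shade increases.
[cite: Hauser2010, §G (kangaroo points), §K] -/
theorem isKangarooPoint_antelope [CharP K 2] :
    IsKangarooPoint 2 1 ![(1 : K), 0] (State.mk (antelopeResidual K) antelopeMult) :=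
  ⟨by simp, isEquimultiplePoint_antelope K, shadeIncreases_antelope K⟩

/-- **An antelope point of the model.** [cite: Hauser2010, §G (antelope points), §K] -/
theorem isAntelopePoint_antelope [CharP K 2] :
    IsAntelopePoint 2 (State.mk (antelopeResidual K) antelopeMult) :=
  ⟨1, ![1, 0], isKangarooPoint_antelope K⟩

/-- **The kangaroo cannot jump again.** At every point `b'` (`b'_{j'} = 0`) of every chart
`y_{j'}` of the next point blow-up of the kangaroo state `(z⁶(y⁵ + y³), (0, 6))`, the shade does
not increase — the instance on Hauser's example of
`PointBlowup.not_shadeIncreases_step_of_shadeIncreases` (no two consecutive increases at order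
`p`, every dimension). [cite: Hauser2010, §F (p. 16: "in the next blowup the shade has to drop at
least by 1 (if e = 1)" — only "does not increase" is asserted here)] [cite: Moh1987, §1 (p. 972)] -/
theorem not_shadeIncreases_after_kangaroo [CharP K 2] (j' : Fin 2) (b' : Fin 2 → K)
    (hbj' : b' j' = 0) :
    ¬ ShadeIncreases 2 j' b'
      (State.mk (X 0 ^ 5 * X 1 ^ 6 + X 0 ^ 3 * X 1 ^ 6) kangarooMult) := by
  have hord : ((2 : ℕ) : ℕ∞) ≤
      ordZero (step 2 1 ![(1 : K), 0] (State.mk (antelopeResidual K) antelopeMult)).F := by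
    rw [step_antelope]
    show ((2 : ℕ) : ℕ∞) ≤ ordZero (X 0 ^ 5 * X 1 ^ 6 + X 0 ^ 3 * X 1 ^ 6 : MvPolynomial (Fin 2) K)
    rw [ordZero_kangarooClean K]
    exact_mod_cast (show (2 : ℕ) ≤ 9 by norm_num)
  have h := not_shadeIncreases_step_of_shadeIncreases 2 1 ![(1 : K), 0] (by simp)
    (State.mk (antelopeResidual K) antelopeMult) (deletePthPowers_antelopeResidual K)
    (ordZero_antelopeResidual K) (show (2 : ℕ) ≤ 8 by norm_num) (antelopeMult_le_of_mem_support K)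
    (shadeIncreases_antelope K) j' b' hbj' hord
  rwa [step_antelope] at h

/-! ### The stall at the origin of the `z`-chart above the kangaroo -/

/-- **The next step at the origin of the `z`-chart**: `(z⁶(y⁵ + y³), (0,6)) ↦ (y⁵z⁹ + y³z⁷, (0,7))`
(nothing to clean; the new component `z = 0` gets `9 − 2 = 7`). [cite: Hauser2010, §F] -/
theorem step_kangaroo_origin :
    step 2 1 (0 : Fin 2 → K)
        (State.mk (X 0 ^ 5 * X 1 ^ 6 + X 0 ^ 3 * X 1 ^ 6 : MvPolynomial (Fin 2) K) kangarooMult) =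
      State.mk (X 0 ^ 5 * X 1 ^ 9 + X 0 ^ 3 * X 1 ^ 7) (Finsupp.single 1 7) := by
  show State.mk (deletePthPowers 2 (pointTransform 2 1 (0 : Fin 2 → K)
      (State.mk (X 0 ^ 5 * X 1 ^ 6 + X 0 ^ 3 * X 1 ^ 6 : MvPolynomial (Fin 2) K) kangarooMult)))
      (newMult 2 1 (0 : Fin 2 → K)
        (State.mk (X 0 ^ 5 * X 1 ^ 6 + X 0 ^ 3 * X 1 ^ 6 : MvPolynomial (Fin 2) K) kangarooMult)) = _
  congr 1
  · rw [pointTransform_kangaroo_origin, X_pow_mul_X_pow, X_pow_mul_X_pow]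
    exact deletePthPowers_binomial 2 (not_isPthPowerExponent_two_of_odd rfl 9)
      (not_isPthPowerExponent_two_of_odd rfl 7)
  · rw [newMult_eq 2 1 _ rfl _ (ordZero_kangarooClean K)]
    ext i
    fin_cases i <;> simp [kangarooMult]

/-- The origin of the `z`-chart above the kangaroo is **equimultiple** (order `10 ≥ 2`).
[cite: Hauser2010, §F (equiconstant points)] -/
theorem isEquimultiplePoint_kangaroo_origin :
    IsEquimultiplePoint 2 1 (0 : Fin 2 → K)
      (State.mk (X 0 ^ 5 * X 1 ^ 6 + X 0 ^ 3 * X 1 ^ 6 : MvPolynomial (Fin 2) K) kangarooMult) := by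
  intro d _ hdeg
  rw [pointTransform_kangaroo_origin]
  by_contra h
  have h10 := ordZero_le_of_coeff_ne_zero _ d h
  rw [ordZero_kangarooOriginClean K] at h10
  have : (10 : ℕ) ≤ d.degree := by exact_mod_cast h10
  omega

/-- **The shade STALLS at the origin of the `z`-chart above the kangaroo**: `10 − 7 = 3 = 9 − 6`
— after the jump the shade does not increase (`not_shadeIncreases_after_kangaroo`) but need not
drop either, at an equimultiple point of a point blow-up. Scope remark on the paraphrase "in the
next blowup the shade has to drop at least by 1 (if `e = 1`)" [Hauser2010, §F p. 16]: not
point-by-point in this model. [cite: Hauser2010, §F (p. 16)] [cite: Moh1987, Stability Theorem (p. 966)] -/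
theorem shadeStalls_kangaroo_origin :
    ShadeStalls 2 1 (0 : Fin 2 → K)
      (State.mk (X 0 ^ 5 * X 1 ^ 6 + X 0 ^ 3 * X 1 ^ 6 : MvPolynomial (Fin 2) K) kangarooMult) := by
  unfold ShadeStalls
  rw [step_kangaroo_origin, shade_kangarooClean,
    shade_eq_of_ordZero_eq _ (ordZero_kangarooOriginClean K)]
  simp [Finsupp.degree_eq_sum]

/-- Summary for the example: an antelope point of the model; the jump at the kangaroo point is
exactly `+1 = p^{e−1}`; no point of the next blow-up of the kangaroo state increases the shade
again; and the origin of the `z`-chart is an equimultiple point where it stalls.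
[cite: Hauser2010, §§F, G, K] [cite: Moh1987, Stability Theorem] -/
theorem kangaroo_example_summary [CharP K 2] :
    IsAntelopePoint 2 (State.mk (antelopeResidual K) antelopeMult) ∧
    (step 2 1 ![(1 : K), 0] (State.mk (antelopeResidual K) antelopeMult)).shade =
      (State.mk (antelopeResidual K) antelopeMult).shade + 1 ∧
    (∀ (j' : Fin 2) (b' : Fin 2 → K), b' j' = 0 →
      ¬ ShadeIncreases 2 j' b' (step 2 1 ![(1 : K), 0] (State.mk (antelopeResidual K) antelopeMult))) ∧
    IsEquimultiplePoint 2 1 (0 : Fin 2 → K)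
      (step 2 1 ![(1 : K), 0] (State.mk (antelopeResidual K) antelopeMult)) ∧
    ShadeStalls 2 1 (0 : Fin 2 → K)
      (step 2 1 ![(1 : K), 0] (State.mk (antelopeResidual K) antelopeMult)) := by
  refine ⟨isAntelopePoint_antelope K, ?_, fun j' b' hbj' => ?_, ?_, ?_⟩
  · rw [shade_step_antelope, shade_antelope]; norm_num
  · rw [step_antelope]; exact not_shadeIncreases_after_kangaroo K j' b' hbj'
  · rw [step_antelope]; exact isEquimultiplePoint_kangaroo_origin K
  · rw [step_antelope]; exact shadeStalls_kangaroo_origin K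

end KangarooExample

end PointBlowup

end Literature.AlgebraicGeometry.Resolution
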